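import Summits.QuantumFields.YangMills.Theorems.EquipartitionCriticalityEquipartitionPinsProbeLocalLaw
import Summits.QuantumFields.YangMills.Theorems.DirichletWindowLocalGaussianityGaussMoments
import Summits.QuantumFields.YangMills.Theorems.DirichletWindowLocalGaussianityTruncation
import Literature.MathematicalPhysics.QuantumLattice.ContinuumLimitLGT
import HarnessLib

/-!
# The second-order local free-gluon law on the axis from the tangent law and exponential moments

Support file for the statement item `stmt-QuantumFields-12314`
(`Summit.QuantumFields.YangMills.Theses.DirichletWindow.LocalGaussianity`), line «exp-moment tangent law», stub
`stub_secondOrderLocalLaw` — its route-independent core (no `Theses` import):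

* `SecondOrder.cov_scaled_eq` — the covariance of the scaled costs `β(N − P₀)`, `β(N − P_x)` in a state `μ` is
  `β² · plaquetteCorrFn ρ μ x`;
* `SecondOrder.secondOrder_of_expMoment` — for a compact simple `G` (Borel σ-algebra `borel G`) and a faithful
  unitary `r`, GIVEN the free-energy asymptotics `f_r(β) + (3D_r/2) log β → K` (item 8759) and the chessboard
  exponential moment `∫ exp((β/2)(N − Re tr r(U_{(x;0,1)}))) dμ ≤ C` for `β ≥ β₁`, all torus-limit states `μ` and all
  sites `x` (stub `stub_expMomentBound`): there is `D ≥ 1` with, for every `n` and `ε > 0`, eventually in `β` and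
  uniformly over `μ ∈ infiniteVolumeLimitPoints r.ρ β`,
  `|β² f_β(n e₀) − (D/2) c'_n²| < ε`, `c'_n = curvatureTwoPoint (0;0,1) (n e₀;0,1)`.
  Proof (contradiction wrapper, as the tree's `EquipartitionPinsProbe.stub_localLaw`): a bad sequence `β_k → ∞`,
  `μ_k` has a tangent law `τ` (`EquipartitionPinsProbe.stub_tangent`, fed with `stub_equipartition`), identified by
  rigidity (`stub_rigidity` and the landed R/F-stubs) as `curvatureGaussianField 4 D`; (T0) at the two in-line
  `(0,1)`-plaquettes with the bounded continuous test functions `(v₀ ∧ M)(v₁ ∧ M)`, `vᵢ ∧ M` gives the truncated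
  covariances; the truncation error is `O(1/M)` uniformly in `k` by the first bullet, and on the Gaussian side the
  truncated covariances converge to `Cov(Q₀, Q_n) = (D/2) c'_n²` (`GaussMoments.tendsto_truncated_cov`, Isserlis).

References: S. Chatterjee, arXiv:1602.01222 §§11–14 (local free-gluon law), arXiv:1803.01950 Problem 5.1;
Fröhlich–Israel–Lieb–Simon 1978 (exponential moments).  [folklore] bookkeeping; no rung or summit statement is
proved here.
-/

noncomputable section

open MeasureTheory Filter Topology
open Literature.MathematicalPhysics.QuantumFieldTheory Literature.MathematicalPhysics.QuantumLattice

namespace Summit.QuantumFields.YangMills.Theorems.LocalGaussianityExpMomentTangentLaw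

namespace SecondOrder

/-! ### Covariance of scaled plaquette costs = `β²` × plaquette correlation -/

section Lattice

variable {G : Type} [Group G] [MeasurableSpace G] {N : ℕ} (ρ : G →* Matrix (Fin N) (Fin N) ℂ)

/-- For a probability measure `μ` on `LGConfig 4 G` and integrable plaquette observables: the covariance of the
scaled costs `β(N − P₀)`, `β(N − P_x)` is `β² · plaquetteCorrFn ρ μ x`. -/
theorem cov_scaled_eq (μ : Measure (LGConfig 4 G)) [IsProbabilityMeasure μ] (β : ℝ)
    (x : Literature.Probability.LatticeModels.Site 4)
    (h0 : Integrable (plaquetteObs ρ 0 0 1) μ) (hx : Integrable (plaquetteObs ρ x 0 1) μ)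
    (h0x : Integrable (fun U => plaquetteObs ρ 0 0 1 U * plaquetteObs ρ x 0 1 U) μ) :
    (∫ U, (β * ((N : ℝ) - plaquetteObs ρ 0 0 1 U)) * (β * ((N : ℝ) - plaquetteObs ρ x 0 1 U)) ∂μ) -
      (∫ U, β * ((N : ℝ) - plaquetteObs ρ 0 0 1 U) ∂μ) * (∫ U, β * ((N : ℝ) - plaquetteObs ρ x 0 1 U) ∂μ) =
      β ^ 2 * plaquetteCorrFn ρ μ x := by
  have hprod : ∀ U, (β * ((N : ℝ) - plaquetteObs ρ 0 0 1 U)) * (β * ((N : ℝ) - plaquetteObs ρ x 0 1 U)) =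
      β ^ 2 * (N : ℝ) ^ 2 - β ^ 2 * N * plaquetteObs ρ x 0 1 U - β ^ 2 * N * plaquetteObs ρ 0 0 1 U +
        β ^ 2 * (plaquetteObs ρ 0 0 1 U * plaquetteObs ρ x 0 1 U) := fun U => by ring
  have hlin : ∀ (y : Literature.Probability.LatticeModels.Site 4), Integrable (plaquetteObs ρ y 0 1) μ →
      ∫ U, β * ((N : ℝ) - plaquetteObs ρ y 0 1 U) ∂μ = β * N - β * ∫ U, plaquetteObs ρ y 0 1 U ∂μ := by
    intro y hy
    rw [integral_const_mul, integral_sub (integrable_const _) hy, integral_const, probReal_univ, one_smul]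
    ring
  simp_rw [hprod]
  have i1 : Integrable (fun U => β ^ 2 * (N : ℝ) ^ 2 - β ^ 2 * N * plaquetteObs ρ x 0 1 U -
      β ^ 2 * N * plaquetteObs ρ 0 0 1 U) μ := ((integrable_const _).sub (hx.const_mul _)).sub (h0.const_mul _)
  have i2 : Integrable (fun U => β ^ 2 * (plaquetteObs ρ 0 0 1 U * plaquetteObs ρ x 0 1 U)) μ :=
    h0x.const_mul _
  have i3 : Integrable (fun U => β ^ 2 * (N : ℝ) ^ 2 - β ^ 2 * N * plaquetteObs ρ x 0 1 U) μ :=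
    (integrable_const _).sub (hx.const_mul _)
  have i4 : Integrable (fun U => β ^ 2 * N * plaquetteObs ρ x 0 1 U) μ := hx.const_mul _
  have i5 : Integrable (fun U => β ^ 2 * N * plaquetteObs ρ 0 0 1 U) μ := h0.const_mul _
  rw [integral_add i1 i2, integral_sub i3 i5, integral_sub (integrable_const _) i4, integral_const,
    probReal_univ, one_smul, integral_const_mul, integral_const_mul, integral_const_mul, hlin 0 h0, hlin x hx]
  unfold plaquetteCorrFn plaquetteCorr
  ring

end Lattice

/-! ### The second-order local law (contradiction wrapper) -/

open Summit.QuantumFields.YangMills.Theorems.EquipartitionPinsProbe in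
/-- **The second-order local free-gluon law on the axis, from the tangent law and chessboard exponential moments.**
For a compact simple `G` (with its Borel σ-algebra) and a faithful unitary lattice representation `r`, GIVEN the
free-energy asymptotics `f_r(β) + (3D_r/2) log β → K` and uniform exponential moments of the scaled `(0,1)`-plaquette
cost over torus-limit states at large `β`: there is `D ≥ 1` such that for every `n : ℕ` and `ε > 0` there is `β₁`
with `|β² f_β(n e₀) − (D/2) · (curvatureTwoPoint (0;0,1) (n e₀;0,1))²| < ε` for all `β ≥ β₁` and all
`μ ∈ infiniteVolumeLimitPoints r.ρ β`. -/
theorem secondOrder_of_expMoment :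
    ∀ (G : Type) [Group G] [TopologicalSpace G] [IsTopologicalGroup G] [CompactSpace G],
      IsCompactSimpleLieGroup G →
      letI : MeasurableSpace G := borel G
      haveI : BorelSpace G := ⟨rfl⟩
      ∀ r : LatticeRep G,
        (∃ K : ℝ, Tendsto (fun β : ℝ => freeEnergyDensity 4 r.ρ β +
          (3 * (Module.finrank ℝ ↥(Submodule.span ℝ {X : Matrix (Fin r.N) (Fin r.N) ℂ |
            ∀ t : ℝ, NormedSpace.exp ((t : ℂ) • X) ∈ Set.range r.ρ}) : ℝ) / 2) * Real.log β) atTop (nhds K)) →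
        (∃ C β₁ : ℝ, ∀ β : ℝ, β₁ ≤ β → ∀ μ ∈ infiniteVolumeLimitPoints (d := 4) r.ρ β,
          ∀ x : Literature.Probability.LatticeModels.Site 4,
            ∫ U, Real.exp (β / 2 * ((r.N : ℝ) - plaquetteObs r.ρ x 0 1 U)) ∂μ ≤ C) →
        ∃ D : ℕ, 0 < D ∧ ∀ (n : ℕ) (ε : ℝ), 0 < ε → ∃ β₁ : ℝ, ∀ β : ℝ, β₁ ≤ β →
          ∀ μ ∈ infiniteVolumeLimitPoints (d := 4) r.ρ β,
            |β ^ 2 * plaquetteCorrFn r.ρ μ (Pi.single (0 : Fin 4) (n : ℤ)) -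
              (D : ℝ) / 2 * curvatureTwoPoint
                (((0 : Literature.Probability.LatticeModels.Site 4)), ⟨((0 : Fin 4), (1 : Fin 4)), Fin.zero_lt_one⟩)
                (((Pi.single (0 : Fin 4) (n : ℤ) : Literature.Probability.LatticeModels.Site 4)),
                  ⟨((0 : Fin 4), (1 : Fin 4)), Fin.zero_lt_one⟩) ^ 2| < ε := by
  intro G _ _ _ _ hG
  letI : MeasurableSpace G := borel G
  haveI : BorelSpace G := ⟨rfl⟩
  intro r hK hexp
  haveI : SecondCountableTopology G :=
    (r.continuous.isClosedEmbedding r.injective).isEmbedding.secondCountableTopology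
  obtain ⟨D, hD, hTan⟩ := stub_tangent G hG r (stub_equipartition G hG r hK)
  have hR := stub_rigidity
    (stub_factorization (stub_exactShiftInvariance stub_steinFlow stub_kernelFixesExact)
      (stub_cubeShiftInvariance stub_kernelClosed) stub_density)
    stub_cosMoment stub_lineVariance stub_gaussFromCharFun
  obtain ⟨C, β₁, hC⟩ := hexp
  refine ⟨D, hD, fun n ε hε => ?_⟩
  set zn : Literature.Probability.LatticeModels.Site 4 := Pi.single (0 : Fin 4) (n : ℤ) with hzn
  set p0 : ZdPlaquette 4 :=
    (((0 : Literature.Probability.LatticeModels.Site 4)), ⟨((0 : Fin 4), (1 : Fin 4)), Fin.zero_lt_one⟩) with hp0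
  set pn : ZdPlaquette 4 := ((zn, ⟨((0 : Fin 4), (1 : Fin 4)), Fin.zero_lt_one⟩) : ZdPlaquette 4) with hpn
  set L : ℝ := (D : ℝ) / 2 * curvatureTwoPoint p0 pn ^ 2 with hL
  by_contra hcon
  push Not at hcon
  choose βs hβs μs hμs hbad using fun k : ℕ => hcon (max (k : ℝ) β₁)
  have hβk : ∀ k : ℕ, (k : ℝ) ≤ βs k := fun k => (le_max_left _ _).trans (hβs k)
  have hβ1 : ∀ k, β₁ ≤ βs k := fun k => (le_max_right _ _).trans (hβs k)
  have hβ0 : ∀ k, 0 ≤ βs k := fun k => (Nat.cast_nonneg k).trans (hβk k)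
  have hβtend : Tendsto βs atTop atTop := tendsto_atTop_mono hβk tendsto_natCast_atTop_atTop
  obtain ⟨φ, τ, hφ, hτ, hT0, hT1, hT2, hT3⟩ := hTan βs μs hβtend hμs
  have hτeq : τ = curvatureGaussianField 4 D := hR D τ hτ hT1 hT2 hT3
  subst hτeq
  have hprob : ∀ k, IsProbabilityMeasure (μs k) := fun k => by
    obtain ⟨Lk, -, hP, -⟩ := hμs k
    exact hP
  -- the plaquette observables and the scaled costs
  have hPc : ∀ x : Literature.Probability.LatticeModels.Site 4, Continuous (plaquetteObs r.ρ x 0 1) :=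
    fun x => continuous_plaquetteObs r.ρ r.continuous x 0 1
  have hPabs : ∀ (x : Literature.Probability.LatticeModels.Site 4) (U : LGConfig 4 G),
      |plaquetteObs r.ρ x 0 1 U| ≤ r.N := fun x U => by
    have h := Literature.RepresentationTheory.CompactGroups.CompactGroup.abs_re_trace_le_card r.ρ r.continuous
      (plaquetteHolonomyZd U x 0 1)
    simpa only [Fintype.card_fin, plaquetteObs] using h
  have hPi : ∀ (k : ℕ) (x : Literature.Probability.LatticeModels.Site 4), Integrable (plaquetteObs r.ρ x 0 1) (μs k) :=
    fun k x => by
      haveI := hprob k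
      exact integrable_of_abs_le (hPc x).aestronglyMeasurable (hPabs x)
  have hPPi : ∀ (k : ℕ) (x : Literature.Probability.LatticeModels.Site 4),
      Integrable (fun U => plaquetteObs r.ρ 0 0 1 U * plaquetteObs r.ρ x 0 1 U) (μs k) := fun k x => by
    haveI := hprob k
    exact integrable_of_abs_le ((hPc 0).mul (hPc x)).aestronglyMeasurable (K := (r.N : ℝ) * r.N) fun U => by
      rw [abs_mul]
      exact mul_le_mul (hPabs 0 U) (hPabs x U) (abs_nonneg _) (Nat.cast_nonneg _)
  set X : ℕ → Literature.Probability.LatticeModels.Site 4 → LGConfig 4 G → ℝ :=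
    fun k x U => βs k * ((r.N : ℝ) - plaquetteObs r.ρ x 0 1 U) with hX
  have hX0 : ∀ k x U, 0 ≤ X k x U := fun k x U =>
    mul_nonneg (hβ0 k) (sub_nonneg.2 (abs_le.1 (hPabs x U)).2)
  have hXB : ∀ k x U, X k x U ≤ βs k * (2 * r.N) := fun k x U =>
    mul_le_mul_of_nonneg_left (by linarith [(abs_le.1 (hPabs x U)).1]) (hβ0 k)
  have hXm : ∀ k x, AEStronglyMeasurable (X k x) (μs k) := fun k x =>
    (continuous_const.mul (continuous_const.sub (hPc x))).aestronglyMeasurable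
  have hXe : ∀ (k : ℕ) (x : Literature.Probability.LatticeModels.Site 4),
      ∫ U, Real.exp (X k x U / 2) ∂(μs k) ≤ C := fun k x => by
    have h := hC (βs k) (hβ1 k) (μs k) (hμs k) x
    have heq : (fun U => Real.exp (X k x U / 2)) =
        fun U => Real.exp (βs k / 2 * ((r.N : ℝ) - plaquetteObs r.ρ x 0 1 U)) := by
      funext U
      congr 1
      simp only [hX]
      ring
    rw [heq]
    exact h
  -- uniform truncation error (the exponential moments give uniform integrability)
  have htrunc : ∀ (k : ℕ) {M : ℝ}, 0 < M →
      |((∫ U, X k 0 U * X k zn U ∂(μs k)) - (∫ U, X k 0 U ∂(μs k)) * (∫ U, X k zn U ∂(μs k))) -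
        ((∫ U, min (max (X k 0 U) 0) M * min (max (X k zn U) 0) M ∂(μs k)) -
          (∫ U, min (max (X k 0 U) 0) M ∂(μs k)) * (∫ U, min (max (X k zn U) 0) M ∂(μs k)))| ≤
        (96 * C + 32 * C ^ 2) / M := fun k M hM => by
    haveI := hprob k
    exact abs_cov_sub_truncated_le (hXm k 0) (hXm k zn) (hX0 k 0) (hX0 k zn) (hXB k 0) (hXB k zn)
      (hXe k 0) (hXe k zn) hM
  -- the covariance of the scaled costs is `β² f_β(n e₀)`
  have hcov : ∀ k, (∫ U, X k 0 U * X k zn U ∂(μs k)) - (∫ U, X k 0 U ∂(μs k)) * (∫ U, X k zn U ∂(μs k)) =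
      βs k ^ 2 * plaquetteCorrFn r.ρ (μs k) zn := fun k => by
    haveI := hprob k
    exact cov_scaled_eq r.ρ (μs k) (βs k) zn (hPi k 0) (hPi k zn) (hPPi k zn)
  -- the Gaussian side: truncated covariances → `L`
  have hGauss := GaussMoments.tendsto_truncated_cov D p0 pn
  have hKM : Tendsto (fun M : ℕ => (96 * C + 32 * C ^ 2) / (M : ℝ)) atTop (𝓝 0) :=
    tendsto_const_div_atTop_nhds_zero_nat _
  have hε3 : 0 < ε / 3 := by positivity
  obtain ⟨M, hM1, hMG, hMK⟩ : ∃ M : ℕ, 1 ≤ M ∧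
      dist ((∫ Y, min (max ((1 / 2 : ℝ) * ∑ a : Fin D, (Y p0 a) ^ 2) 0) (M : ℝ) *
          min (max ((1 / 2 : ℝ) * ∑ b : Fin D, (Y pn b) ^ 2) 0) (M : ℝ) ∂(curvatureGaussianField 4 D)) -
        (∫ Y, min (max ((1 / 2 : ℝ) * ∑ a : Fin D, (Y p0 a) ^ 2) 0) (M : ℝ) ∂(curvatureGaussianField 4 D)) *
          (∫ Y, min (max ((1 / 2 : ℝ) * ∑ b : Fin D, (Y pn b) ^ 2) 0) (M : ℝ) ∂(curvatureGaussianField 4 D)))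
        L < ε / 3 ∧
      (96 * C + 32 * C ^ 2) / (M : ℝ) < ε / 3 :=
    ((eventually_ge_atTop 1).and (((Metric.tendsto_nhds.1 hGauss) (ε / 3) hε3).and
      (hKM.eventually (gt_mem_nhds hε3)))).exists
  have hM0 : (0 : ℝ) < M := by exact_mod_cast hM1
  rw [Real.dist_eq] at hMG
  -- (T0) at the two plaquettes with the truncated test functions
  set cM : ℝ → ℝ := fun t => min (max t 0) (M : ℝ) with hcM
  have hcMc : Continuous cM := GaussMoments.continuous_clamp (M : ℝ)
  have hcMb : ∀ t, |cM t| ≤ M := fun t => GaussMoments.abs_clamp_le t (Nat.cast_nonneg M)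
  set f2 : (Fin 2 → ℝ) → ℝ := fun v => cM (v 0) * cM (v 1) with hf2
  set fa : (Fin 2 → ℝ) → ℝ := fun v => cM (v 0) with hfa
  set fb : (Fin 2 → ℝ) → ℝ := fun v => cM (v 1) with hfb
  have hf2c : Continuous f2 := (hcMc.comp (continuous_apply 0)).mul (hcMc.comp (continuous_apply 1))
  have hfac : Continuous fa := hcMc.comp (continuous_apply 0)
  have hfbc : Continuous fb := hcMc.comp (continuous_apply 1)
  have hf2b : ∃ C' : ℝ, ∀ v, |f2 v| ≤ C' := ⟨(M : ℝ) * M, fun v => by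
    simp only [hf2, abs_mul]
    exact mul_le_mul (hcMb _) (hcMb _) (abs_nonneg _) (Nat.cast_nonneg M)⟩
  have hfab : ∃ C' : ℝ, ∀ v, |fa v| ≤ C' := ⟨M, fun v => hcMb _⟩
  have hfbb : ∃ C' : ℝ, ∀ v, |fb v| ≤ C' := ⟨M, fun v => hcMb _⟩
  have l2 := hT0 2 ![p0, pn] f2 hf2c hf2b
  have la := hT0 2 ![p0, pn] fa hfac hfab
  have lb := hT0 2 ![p0, pn] fb hfbc hfbb
  -- identify the lattice integrands
  have hq0 : ∀ (U : LGConfig 4 G), plaquetteObs r.ρ p0.1 p0.2.1.1 p0.2.1.2 U = plaquetteObs r.ρ 0 0 1 U := by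
    intro U; simp [hp0]
  have hqn : ∀ (U : LGConfig 4 G), plaquetteObs r.ρ pn.1 pn.2.1.1 pn.2.1.2 U = plaquetteObs r.ρ zn 0 1 U := by
    intro U; simp [hpn]
  have hL2 : ∀ (j : ℕ) (U : LGConfig 4 G),
      f2 (fun i => βs (φ j) * ((r.N : ℝ) - plaquetteObs r.ρ
          ((![p0, pn] : Fin 2 → ZdPlaquette 4) i).1 ((![p0, pn] : Fin 2 → ZdPlaquette 4) i).2.1.1
          ((![p0, pn] : Fin 2 → ZdPlaquette 4) i).2.1.2 U)) =
        cM (X (φ j) 0 U) * cM (X (φ j) zn U) := by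
    intro j U
    simp only [hf2, hX, Matrix.cons_val_zero, Matrix.cons_val_one, Matrix.cons_val_fin_one, hq0, hqn]
  have hLa : ∀ (j : ℕ) (U : LGConfig 4 G),
      fa (fun i => βs (φ j) * ((r.N : ℝ) - plaquetteObs r.ρ
          ((![p0, pn] : Fin 2 → ZdPlaquette 4) i).1 ((![p0, pn] : Fin 2 → ZdPlaquette 4) i).2.1.1
          ((![p0, pn] : Fin 2 → ZdPlaquette 4) i).2.1.2 U)) = cM (X (φ j) 0 U) := by
    intro j U
    simp only [hfa, hX, Matrix.cons_val_zero, hq0]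
  have hLb : ∀ (j : ℕ) (U : LGConfig 4 G),
      fb (fun i => βs (φ j) * ((r.N : ℝ) - plaquetteObs r.ρ
          ((![p0, pn] : Fin 2 → ZdPlaquette 4) i).1 ((![p0, pn] : Fin 2 → ZdPlaquette 4) i).2.1.1
          ((![p0, pn] : Fin 2 → ZdPlaquette 4) i).2.1.2 U)) = cM (X (φ j) zn U) := by
    intro j U
    simp only [hfb, hX, Matrix.cons_val_one, Matrix.cons_val_fin_one, hqn]
  -- identify the Gaussian integrands
  have hG2 : ∀ Y : ZdPlaquette 4 → Fin D → ℝ,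
      f2 (fun i => (1 / 2 : ℝ) * ∑ a : Fin D, (Y ((![p0, pn] : Fin 2 → ZdPlaquette 4) i) a) ^ 2) =
        cM ((1 / 2 : ℝ) * ∑ a : Fin D, (Y p0 a) ^ 2) * cM ((1 / 2 : ℝ) * ∑ b : Fin D, (Y pn b) ^ 2) := by
    intro Y
    simp only [hf2, Matrix.cons_val_zero, Matrix.cons_val_one, Matrix.cons_val_fin_one]
  have hGa : ∀ Y : ZdPlaquette 4 → Fin D → ℝ,
      fa (fun i => (1 / 2 : ℝ) * ∑ a : Fin D, (Y ((![p0, pn] : Fin 2 → ZdPlaquette 4) i) a) ^ 2) =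
        cM ((1 / 2 : ℝ) * ∑ a : Fin D, (Y p0 a) ^ 2) := by
    intro Y
    simp only [hfa, Matrix.cons_val_zero]
  have hGb : ∀ Y : ZdPlaquette 4 → Fin D → ℝ,
      fb (fun i => (1 / 2 : ℝ) * ∑ a : Fin D, (Y ((![p0, pn] : Fin 2 → ZdPlaquette 4) i) a) ^ 2) =
        cM ((1 / 2 : ℝ) * ∑ b : Fin D, (Y pn b) ^ 2) := by
    intro Y
    simp only [hfb, Matrix.cons_val_one, Matrix.cons_val_fin_one]
  simp only [hL2, hG2] at l2
  simp only [hLa, hGa] at la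
  simp only [hLb, hGb] at lb
  have lcov := l2.sub (la.mul lb)
  have hev := (Metric.tendsto_nhds.1 lcov) (ε / 3) hε3
  obtain ⟨j, hj⟩ := hev.exists
  rw [Real.dist_eq] at hj
  -- combine at `k = φ j`
  have hk := hbad (φ j)
  have h1 := htrunc (φ j) hM0
  rw [hcov (φ j)] at h1
  simp only [hcM] at hj
  have htri := abs_sub_le (βs (φ j) ^ 2 * plaquetteCorrFn r.ρ (μs (φ j)) zn)
    ((∫ U, min (max (X (φ j) 0 U) 0) M * min (max (X (φ j) zn U) 0) M ∂(μs (φ j))) -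
      (∫ U, min (max (X (φ j) 0 U) 0) M ∂(μs (φ j))) * (∫ U, min (max (X (φ j) zn U) 0) M ∂(μs (φ j)))) L
  have htri2 := abs_sub_le
    ((∫ U, min (max (X (φ j) 0 U) 0) M * min (max (X (φ j) zn U) 0) M ∂(μs (φ j))) -
      (∫ U, min (max (X (φ j) 0 U) 0) M ∂(μs (φ j))) * (∫ U, min (max (X (φ j) zn U) 0) M ∂(μs (φ j))))
    ((∫ Y, min (max ((1 / 2 : ℝ) * ∑ a : Fin D, (Y p0 a) ^ 2) 0) (M : ℝ) *
          min (max ((1 / 2 : ℝ) * ∑ b : Fin D, (Y pn b) ^ 2) 0) (M : ℝ) ∂(curvatureGaussianField 4 D)) -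
        (∫ Y, min (max ((1 / 2 : ℝ) * ∑ a : Fin D, (Y p0 a) ^ 2) 0) (M : ℝ) ∂(curvatureGaussianField 4 D)) *
          (∫ Y, min (max ((1 / 2 : ℝ) * ∑ b : Fin D, (Y pn b) ^ 2) 0) (M : ℝ) ∂(curvatureGaussianField 4 D))) L
  linarith

end SecondOrder

end Summit.QuantumFields.YangMills.Theorems.LocalGaussianityExpMomentTangentLaw

end
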